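import Literature.Computability.Complexity.StackScript
import Literature.Computability.Complexity.StackStreams
import Literature.Computability.Complexity.StackItemLists
import HarnessLib

/-!
# Verified arithmetic on stack programs: the integer square root, and private-bank routines

Literature / complexity toolkit, continuing `StackScript.lean` (numeric scripts `NS`, symbolic
execution `NS.runs_of_eq`) and `StackStreams.lean` (`countLoop`).  Two things:

* **the integer square root** `⌊√x⌋` of a numeral by the digit-by-digit (greedy bit) method on a
  private register bank `SqReg` (file `SqReg.file` with read/write `simp` lemmas): `isqrtRound`
  (one bit: `c := r + 2^i`; `r := c` if `c² ≤ x`; `2^i := 2^i/2`, the power kept as the bit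
  string `pw i = 0^i 1`), `isqrtProg`, the scan invariant `sqrt_scan_step`
  (`r² ≤ x < (r + 2^{i+1})²` is kept), **`runs_isqrtRound`**, **`runs_isqrtProg`**: from
  `src = encodeNat x` (`|encodeNat x| ≤ n`) it ends with `dst = encodeNat (Nat.sqrt x)`, `src`
  kept, scratch clean, within `isqrtCost n = O(n · (2n+5)³)` steps (`Nat.eq_sqrt`);
* **embedding a private-bank routine at a call site**: `graft_base_sum_map` and
  **`Runs.viaBank`** — a run `base F ⟶ base F'` of a routine over `EReg ⊕ ρ` becomes, along an
  injective register assignment `g : ρ → β` into the caller's roles, a run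
  `base T ⟶ base (graft T g F')` of the mapped routine (`Com.map (Sum.map id g)`), for any
  caller file `T` agreeing with `F` on the assigned registers.

(The `FP`-membership of `⌊√·⌋` as a string function is `NatSqrtFP.lean`; here it is a routine
with an explicit step count, callable inside larger stack programs.)

## References

* D. E. Knuth, *The Art of Computer Programming*, Vol. 2, 3rd ed., Addison–Wesley 1998, §4.3.1
  (classical algorithms on multiple-precision numerals; the schoolbook square root).
* T. Nipkow, G. Klein, *Concrete Semantics with Isabelle/HOL*, Springer 2014, §7.2.
  (Folklore material, fully proved here.)
-/

namespace Literature.Computability.Complexity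

open _root_.Computability SProg

/-- Registers of the square-root routine: result `dst`, operand `src`, unary round counter `u`,
the power `p = 2^i`, the candidate `c`, its square `sq`, the comparison flag `f`. [folklore] -/
inductive SqReg
  | dst | src | u | p | c | sq | f
  deriving DecidableEq

namespace SqReg

/-- The register file of the square-root routine. [folklore] -/
def file (d s u p c q f : List Bool) : Regs SqReg
  | .dst => d
  | .src => s
  | .u => u
  | .p => p
  | .c => c
  | .sq => q
  | .f => f

section FileLemmas
variable (d s u p c q f v : List Bool)
/-- Reading `dst`. [folklore] -/ @[simp] theorem file_dst : file d s u p c q f .dst = d := rfl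
/-- Reading `src`. [folklore] -/ @[simp] theorem file_src : file d s u p c q f .src = s := rfl
/-- Reading `u`. [folklore] -/ @[simp] theorem file_u : file d s u p c q f .u = u := rfl
/-- Reading `p`. [folklore] -/ @[simp] theorem file_p : file d s u p c q f .p = p := rfl
/-- Reading `c`. [folklore] -/ @[simp] theorem file_c : file d s u p c q f .c = c := rfl
/-- Reading `sq`. [folklore] -/ @[simp] theorem file_sq : file d s u p c q f .sq = q := rfl
/-- Reading `f`. [folklore] -/ @[simp] theorem file_f : file d s u p c q f .f = f := rfl
/-- Writing `dst`. [folklore] -/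
@[simp] theorem update_file_dst : Function.update (file d s u p c q f) .dst v = file v s u p c q f := by funext i; cases i <;> rfl
/-- Writing `src`. [folklore] -/
@[simp] theorem update_file_src : Function.update (file d s u p c q f) .src v = file d v u p c q f := by funext i; cases i <;> rfl
/-- Writing `u`. [folklore] -/
@[simp] theorem update_file_u : Function.update (file d s u p c q f) .u v = file d s v p c q f := by funext i; cases i <;> rfl
/-- Writing `p`. [folklore] -/
@[simp] theorem update_file_p : Function.update (file d s u p c q f) .p v = file d s u v c q f := by funext i; cases i <;> rfl
/-- Writing `c`. [folklore] -/
@[simp] theorem update_file_c : Function.update (file d s u p c q f) .c v = file d s u p v q f := by funext i; cases i <;> rfl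
/-- Writing `sq`. [folklore] -/
@[simp] theorem update_file_sq : Function.update (file d s u p c q f) .sq v = file d s u p c v f := by funext i; cases i <;> rfl
/-- Writing `f`. [folklore] -/
@[simp] theorem update_file_f : Function.update (file d s u p c q f) .f v = file d s u p c q v := by funext i; cases i <;> rfl
end FileLemmas

end SqReg

namespace Com

open SqReg

/-! ### The routine -/

/-- One round of the digit-by-digit square root: `c := r + P`; if `c² ≤ x` then `r := c`;
then `P := P/2`. [Knuth 1998, §4.3.1] [folklore] -/
def isqrtRound : NS SqReg :=
  .seq (NS.ofList [.add .c .dst .p, .mul .sq .c .c, .cmp .f .src .sq])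
    (.seq (.ite .f (NS.ofList [.clear .dst, .move .c .dst]) (NS.ofList [.clear .c])) (NS.ofList [.clear .sq, .drop .p]))

/-- `isqrtProg`: `dst := ⌊√src⌋` (`src` preserved) by the digit-by-digit method: `K + 1` rounds
for a `K`-bit operand, the power `P` starting at `2^K`. [Knuth 1998, §4.3.1] [folklore] -/
def isqrtProg : Com (EReg ⊕ SqReg) :=
  (NS.ofList [.clear .dst, .len .c .src .sq, .toUnary .u .c, .clear .c, .copy .u .sq, .const .p [true]] : NS SqReg).com ;;
  (countLoop (Sum.inr .sq) (push (Sum.inr SqReg.p) false) ;; (push (Sum.inr SqReg.u) true ;;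
  countLoop (Sum.inr .u) isqrtRound.com))

/-- The square-root scan: from `r² ≤ x < (r + 2^{i+1})²`, one greedy bit decision gives
`r'² ≤ x < (r' + 2^i)²`. [folklore] -/
theorem sqrt_scan_step {x r i : ℕ} (h1 : r * r ≤ x) (h2 : x < (r + 2 ^ (i + 1)) * (r + 2 ^ (i + 1))) :
    let r' := if (r + 2 ^ i) * (r + 2 ^ i) ≤ x then r + 2 ^ i else r
    r' * r' ≤ x ∧ x < (r' + 2 ^ i) * (r' + 2 ^ i) := by
  intro r'
  by_cases h : (r + 2 ^ i) * (r + 2 ^ i) ≤ x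
  · have e : r' = r + 2 ^ i := if_pos h
    rw [e]
    refine ⟨h, ?_⟩
    have : r + 2 ^ i + 2 ^ i = r + 2 ^ (i + 1) := by rw [pow_succ]; ring
    rwa [this]
  · have e : r' = r := if_neg h
    rw [e]
    exact ⟨h1, by omega⟩

/-- The power register: `2^i` as the bit string `0^i 1`. [folklore] -/
def pw (i : ℕ) : List Bool := List.replicate i false ++ [true]

/-- Value of the power register. [folklore] -/
theorem bitsToNat_pw (i : ℕ) : bitsToNat (pw i) = 2 ^ i := by
  induction i with
  | zero => simp [pw, bitsToNat]
  | succ i ih => rw [pw, List.replicate_succ, List.cons_append, bitsToNat_cons, ← pw, ih, pow_succ]; simp; ring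

/-- Length of the power register. [folklore] -/
@[simp] theorem length_pw (i : ℕ) : (pw i).length = i + 1 := by simp [pw]

/-- Halving the power register. [folklore] -/
theorem tail_pw_succ (i : ℕ) : (pw (i + 1)).tail = pw i := by simp [pw, List.replicate_succ]

/-- Cost of `isqrtProg` on a `≤ n`-bit operand (size parameter `2n + 4` for the squares). [folklore] -/
def isqrtCost (n : ℕ) : ℕ := (n + 1) * (476 * (2 * n + 5) ^ 3 + 2) + 3 * n + 160 * (2 * n + 5) ^ 3

/-- **One round.** With `r² ≤ x < (r + 2^{i+1})²`, `dst = r`, `p = 2^i`: `dst := r'` (the greedy bit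
decision), `p := 2^i / 2`. [folklore] -/
theorem runs_isqrtRound {x r i n : ℕ} (hxn : (encodeNat x).length ≤ n) (hi : i ≤ (encodeNat x).length) (h1 : r * r ≤ x)
    (u : List Bool) :
    Runs isqrtRound.com (base (file (encodeNat r) (encodeNat x) u (pw i) [] [] []))
      (base (file (encodeNat (if (r + 2 ^ i) * (r + 2 ^ i) ≤ x then r + 2 ^ i else r)) (encodeNat x) u (pw i).tail [] [] []))
      (409 * (2 * n + 4 + 1) ^ 3) := by
  set K := (encodeNat x).length with hK
  set M := 2 * n + 4 with hM
  have hx2 : x < 2 ^ K := by have := bitsToNat_lt (encodeNat x); rwa [bitsToNat_encodeNat] at this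
  have hrx : r ≤ x := by
    rcases Nat.eq_zero_or_pos r with h0 | hr
    · omega
    · nlinarith
  have hlr : (encodeNat r).length ≤ M := (Brick.length_encodeNat_mono hrx).trans (by omega)
  have hc2 : r + 2 ^ i < 2 ^ (K + 1) := by
    have : 2 ^ i ≤ 2 ^ K := Nat.pow_le_pow_right (by norm_num) hi
    rw [pow_succ]; omega
  have hlc : (encodeNat (r + 2 ^ i)).length ≤ M := by
    rw [TM2Pass.length_encodeNat_eq_size]; exact (Nat.size_le.2 hc2).trans (by omega)
  have hlsq : (encodeNat ((r + 2 ^ i) * (r + 2 ^ i))).length ≤ M := by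
    rw [TM2Pass.length_encodeNat_eq_size]
    refine (Nat.size_le.2 (show (r + 2 ^ i) * (r + 2 ^ i) < 2 ^ (K + 1 + (K + 1)) by rw [pow_add]; exact Nat.mul_lt_mul'' hc2 hc2)).trans ?_
    omega
  by_cases hcmp : (r + 2 ^ i) * (r + 2 ^ i) ≤ x
  · rw [if_pos hcmp]
    refine NS.runs_of_eq (N := M) _ _ ?_ ?_ (by simp [isqrtRound, hM])
    · simp only [isqrtRound, NS.ofList, NS.ok, NOp.ok, NS.eval, NOp.eval, ne_eq, reduceCtorEq, not_false_eq_true, file_dst, file_p, file_c,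
        file_sq, file_src, file_f, update_file_c, update_file_sq, update_file_f, update_file_dst, bitsToNat_encodeNat, bitsToNat_pw,
        List.length_nil, hcmp, decide_true, flag_true, true_and, and_true, List.append_nil, length_pw, ite_true]
      exact ⟨⟨⟨hlr, by omega, by omega⟩, ⟨hlc, hlc, by omega⟩, by omega, hlsq⟩, Or.inl ⟨hlr, hlc⟩, hlsq⟩
    · simp [isqrtRound, bitsToNat_pw, hcmp]
  · rw [if_neg hcmp]
    refine NS.runs_of_eq (N := M) _ _ ?_ ?_ (by simp [isqrtRound, hM])
    · simp only [isqrtRound, NS.ofList, NS.ok, NOp.ok, NS.eval, NOp.eval, ne_eq, reduceCtorEq, not_false_eq_true, file_dst, file_p, file_c,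
        file_sq, file_src, file_f, update_file_c, update_file_sq, update_file_f, update_file_dst, bitsToNat_encodeNat, bitsToNat_pw,
        List.length_nil, hcmp, decide_false, flag_false, true_and, and_true, List.append_nil, length_pw, ite_false, false_and, false_or]
      exact ⟨⟨⟨hlr, by omega, by omega⟩, ⟨hlc, hlc, by omega⟩, by omega, hlsq⟩, hlc, hlsq⟩
    · simp [isqrtRound, bitsToNat_pw, hcmp]

/-- **Simulation of `isqrtProg`.** [Knuth 1998, §4.3.1] [folklore] -/
theorem runs_isqrtProg {x n : ℕ} (hxn : (encodeNat x).length ≤ n) (d : List Bool) (hd : d.length ≤ n) :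
    Runs isqrtProg (base (file d (encodeNat x) [] [] [] [] [])) (base (file (encodeNat (Nat.sqrt x)) (encodeNat x) [] [] [] [] [])) (isqrtCost n) := by
  set K := (encodeNat x).length with hK
  set M := 2 * n + 4 with hM
  set cc := (M + 1) ^ 3 with hcc
  have hKn : K ≤ n := hxn
  have hx2 : x < 2 ^ K := by
    have := bitsToNat_lt (encodeNat x); rwa [bitsToNat_encodeNat] at this
  have hlK : (encodeNat K).length ≤ M := (length_encodeNat_le_self K).trans (by omega)
  have h1 : Runs (NS.ofList [.clear .dst, .len .c .src .sq, .toUnary .u .c, .clear .c, .copy .u .sq, .const .p [true]] : NS SqReg).com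
      (base (file d (encodeNat x) [] [] [] [] [])) (base (file [] (encodeNat x) (List.replicate K true) [true] [] (List.replicate K true) [])) (155 * cc) := by
    refine NS.runs_of_eq (N := M) _ _ ?_ ?_ (by simp [hcc])
    · simp only [NS.ofList, NS.ok, NOp.ok, NS.eval, NOp.eval, ne_eq, reduceCtorEq, not_false_eq_true, file_src, file_c, file_sq, file_u, file_p, file_dst,
        update_file_c, update_file_u, update_file_sq, update_file_dst, bitsToNat_encodeNat, List.length_nil, List.length_replicate, List.append_nil, ← hK, true_and]
      exact ⟨by omega, ⟨by omega, by omega, trivial⟩, ⟨hlK, by omega⟩, hlK, by omega, ⟨by omega, by simp; omega⟩, trivial⟩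
    · simp [← hK]
  -- build `p := 2^K`
  have h2 := runs_countLoop (U := (Sum.inr .sq : EReg ⊕ SqReg)) (body := push (Sum.inr SqReg.p) false)
    (fun kc R => kc ≤ K ∧ R = base (file [] (encodeNat x) (List.replicate K true) (pw (K - kc)) [] (List.replicate kc true) [])) 1
    (by
      rintro kc R ⟨hkc, rfl⟩ -
      refine ⟨_, (Runs.push _ _ _).of_eq ?_ le_rfl, ?_, by omega, rfl⟩
      · simp only [update_nst_inr, update_file_sq, nst_inr, file_p, update_file_p, pw]
        rw [show K - kc = K - (kc + 1) + 1 by omega, List.replicate_succ, List.cons_append]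
      · simp)
    K (base (file [] (encodeNat x) (List.replicate K true) [true] [] (List.replicate K true) [])) ⟨le_rfl, by simp [pw]⟩ (by simp)
  obtain ⟨R2, hL2, -, -, rfl⟩ := h2
  rw [Nat.sub_zero] at hL2
  -- one more round token
  have h3 : Runs (push (Sum.inr SqReg.u) true : Com (EReg ⊕ SqReg)) (base (file [] (encodeNat x) (List.replicate K true) (pw K) [] [] []))
      (base (file [] (encodeNat x) (List.replicate (K + 1) true) (pw K) [] [] [])) 1 :=
    (Runs.push _ _ _).of_eq (by simp [List.replicate_succ]) le_rfl
  -- the rounds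
  have h4 := runs_countLoop (U := (Sum.inr .u : EReg ⊕ SqReg)) (body := isqrtRound.com)
    (fun kc R => kc ≤ K + 1 ∧ ∃ r, r * r ≤ x ∧ x < (r + 2 ^ kc) * (r + 2 ^ kc) ∧
      R = base (file (encodeNat r) (encodeNat x) (List.replicate kc true) (pw kc).tail [] [] [])) (409 * (2 * n + 4 + 1) ^ 3)
    (by
      rintro kc R ⟨hkc, r, hr1, hr2, rfl⟩ -
      have hr := runs_isqrtRound (n := n) hxn (show kc ≤ (encodeNat x).length by omega) hr1 (List.replicate kc true)
      rw [tail_pw_succ]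
      refine ⟨_, hr.of_eq rfl le_rfl |> fun h => by simpa using h, by simp, by omega, _, (sqrt_scan_step hr1 hr2).1, (sqrt_scan_step hr1 hr2).2, rfl⟩)
    (K + 1) (base (file [] (encodeNat x) (List.replicate (K + 1) true) (pw K) [] [] []))
    ⟨le_rfl, 0, Nat.zero_le _, by rw [zero_add, ← pow_add]; exact hx2.trans (Nat.pow_lt_pow_right (by norm_num) (by omega)), by
      rw [tail_pw_succ]; rfl⟩ (by simp)
  obtain ⟨R4, hL4, -, -, r, hr1, hr2, rfl⟩ := h4
  rw [pow_zero] at hr2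
  have hr : r = Nat.sqrt x := Nat.eq_sqrt.2 ⟨hr1, hr2⟩
  subst hr
  refine (h1.seq (hL2.seq (h3.seq hL4))).of_eq (by simp [pw]) ?_
  unfold isqrtCost
  have hK1 : K ≤ n := hKn
  have : (K + 1) * (409 * (2 * n + 4 + 1) ^ 3 + 2) ≤ (n + 1) * (476 * (2 * n + 5) ^ 3 + 2) :=
    Nat.mul_le_mul (by omega) (by nlinarith [Nat.zero_le ((2 * n + 5) ^ 3)])
  have hc5 : 125 ≤ (2 * n + 4 + 1) ^ 3 := by
    have := Nat.pow_le_pow_left (show 5 ≤ 2 * n + 4 + 1 by omega) 3; simpa using this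
  have e5 : (2 * n + 5) ^ 3 = (2 * n + 4 + 1) ^ 3 := rfl
  rw [e5] at this ⊢
  rw [hcc, hM] at *
  omega

/-! ### Embedding a private-bank routine at a call site -/

/-- Grafting a numeric-layer state along `Sum.map id g` grafts the outer file along `g`. [folklore] -/
theorem graft_base_sum_map {ρ β' : Type} {g : ρ → β'} (hg : Function.Injective g) (T : Regs β') (F' : Regs ρ) :
    graft (base T) (Sum.map id g) (base F') = base (graft T g F') := by
  have hinj : Function.Injective (Sum.map (@id EReg) g) := Sum.map_injective.2 ⟨Function.injective_id, hg⟩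
  funext k
  rcases k with e | b
  · rw [show (Sum.inl e : EReg ⊕ β') = Sum.map id g (Sum.inl e) from rfl, graft_apply _ hinj]; rfl
  · by_cases hb : ∃ r, g r = b
    · obtain ⟨r, rfl⟩ := hb
      rw [show (Sum.inr (g r) : EReg ⊕ β') = Sum.map id g (Sum.inr r) from rfl, graft_apply _ hinj]
      change F' r = graft T g F' (g r)
      rw [graft_apply _ hg]
    · have hb' : ∀ r, g r ≠ b := fun r h => hb ⟨r, h⟩
      rw [graft_of_not _ _ _ (fun i => ?_)]
      · change T b = graft T g F' b
        rw [graft_of_not _ _ _ hb']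
      · rcases i with e | r
        · simp
        · simpa using hb' r

/-- **A private-bank routine runs at a call site**: along an injective register assignment `g`,
from the caller's file `T` agreeing with the routine's initial file on the assigned registers,
to `T` grafted with the routine's final file. [folklore] -/
theorem Runs.viaBank {ρ β' : Type} [DecidableEq ρ] [DecidableEq β'] {g : ρ → β'} (hg : Function.Injective g) {c : Com (EReg ⊕ ρ)}
    {F F' : Regs ρ} {B : ℕ} (h : Runs c (base F) (base F') B) (T : Regs β') (hT : ∀ r, T (g r) = F r) :
    Runs (c.map (Sum.map id g)) (base T) (base (graft T g F')) B := by
  have hinj : Function.Injective (Sum.map (@id EReg) g) := Sum.map_injective.2 ⟨Function.injective_id, hg⟩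
  have hm := Runs.map hinj h (base T) (fun i => by
    rcases i with e | r
    · rfl
    · exact hT r)
  rwa [graft_base_sum_map hg] at hm

end Com

end Literature.Computability.Complexity
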